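import Summits.QuantumFields.YangMills.Theorems.IsotropyFromPowerCountingEngineFromPowerCounting
import Summits.QuantumFields.YangMills.Theorems.PencilRigidityNPointIsotropyPlanarInvariantOfInputsRadial
import Summits.QuantumFields.YangMills.Theorems.PencilRigidityNPointIsotropyStepZeroOfT
import HarnessLib

/-!
# `PencilRigidity.NPointIsotropy` (stmt-QuantumFields-11686) from the ITEMS of route `IsotropyFromPowerCounting`, BY NAME

Generation 12 of line `complex-rotation-bandlimit` (lead c6) reduced the crux `PencilRigidity.NPointIsotropy` to two Yang–Mills
UV inputs — Step 0 (densities on `⁰𝒮`) and the transversely filtered heat-sandwich bound Σ — plus the kernel bound that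
`PencilRigidity.CurvatureKernelBound` supplies; the certificates landed so far (`nPointIsotropy_of_stepZero_sigmaRadial`,
`nPointIsotropy_of_T_sigmaRadial`, `nPointIsotropy_of_items`) QUOTE the texts of those inputs.  Since then the planner filed them as
items of route `IsotropyFromPowerCounting` and restated Σ with the `45°` frame named by coordinates (stmt-QuantumFields-17720 →
stmt-QuantumFields-18372, cone repair rev 3).  This file states the reduction over the route DECLARATIONS THEMSELVES, so that closing
the three items closes this crux by `exact`:

* `nPointIsotropy_of_routeItems` — `IsotropyFromPowerCounting.CurvatureDensities` (stmt-QuantumFields-17723, Step 0, the WEAKEST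
  form the composition consumes) `→ IsotropyFromPowerCounting.CurvatureSandwichBound` (stmt-QuantumFields-18372, Σ)
  `→ PencilRigidity.CurvatureKernelBound` (stmt-QuantumFields-11687) `→ PencilRigidity.NPointIsotropy`;
* `nPointIsotropy_of_routeCruxes` — the same with Step 0 replaced by the crux it follows from,
  `IsotropyFromPowerCounting.TemperedCurvatureMoments` (stmt-QuantumFields-17721, T), through the landed
  `curvatureDensities_of_temperedCurvatureMoments`.

Pure logic over landed files: Σ in `planeRot` vocabulary by `sandwichBound_planeRot_of_curvatureSandwichBound`
(`…IsotropyFromPowerCountingEngineFromPowerCounting.lean`), the radial form of Σ from the kernel bound by `sandwichBoundRadial_of_items`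
(`…StepZeroOfT.lean`, p139269), and the radial composition `nPointIsotropy_of_stepZero_sigmaRadial` (`…PlanarInvariantOfInputsRadial.lean`,
p138998).  The radial-kernel hypothesis of the crux pays for level growth at levels `≤ 1` inside that composition; the `45°` clause of Σ is
used without its threshold.
-/

noncomputable section

namespace Summit.QuantumFields.YangMills.Theorems.NPointIsotropy.ComplexRotationBandlimit

open Summit.QuantumFields.YangMills.Theorems.SoftKernelBoostCovariance.Sketch
  (sandwichBound_planeRot_of_curvatureSandwichBound curvatureDensities_of_temperedCurvatureMoments)

/-- **Crux 11686 from three items, by name (registered certificate `nPointIsotropy_of_routeItems`)**: Step 0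
(`IsotropyFromPowerCounting.CurvatureDensities`, stmt-QuantumFields-17723), the sandwich bound Σ
(`IsotropyFromPowerCounting.CurvatureSandwichBound`, stmt-QuantumFields-18372) and the kernel bound
(`PencilRigidity.CurvatureKernelBound`, stmt-QuantumFields-11687) imply `PencilRigidity.NPointIsotropy` (stmt-QuantumFields-11686). -/
theorem nPointIsotropy_of_routeItems :
    Summit.QuantumFields.YangMills.Theses.IsotropyFromPowerCounting.CurvatureDensities →
    Summit.QuantumFields.YangMills.Theses.IsotropyFromPowerCounting.CurvatureSandwichBound →
    Summit.QuantumFields.YangMills.Theses.PencilRigidity.CurvatureKernelBound →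
    Summit.QuantumFields.YangMills.Theses.PencilRigidity.NPointIsotropy :=
  fun hD hSig hKB =>
    nPointIsotropy_of_stepZero_sigmaRadial hD
      (sandwichBoundRadial_of_items hKB (sandwichBound_planeRot_of_curvatureSandwichBound hSig))

/-- **Crux 11686 from three CRUXES, by name**: T (`IsotropyFromPowerCounting.TemperedCurvatureMoments`, stmt-QuantumFields-17721),
Σ (`IsotropyFromPowerCounting.CurvatureSandwichBound`, stmt-QuantumFields-18372) and `PencilRigidity.CurvatureKernelBound`
(stmt-QuantumFields-11687) imply `PencilRigidity.NPointIsotropy` — Step 0 from T by the landed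
`curvatureDensities_of_temperedCurvatureMoments`. -/
theorem nPointIsotropy_of_routeCruxes
    (hT : Summit.QuantumFields.YangMills.Theses.IsotropyFromPowerCounting.TemperedCurvatureMoments)
    (hSig : Summit.QuantumFields.YangMills.Theses.IsotropyFromPowerCounting.CurvatureSandwichBound)
    (hKB : Summit.QuantumFields.YangMills.Theses.PencilRigidity.CurvatureKernelBound) :
    Summit.QuantumFields.YangMills.Theses.PencilRigidity.NPointIsotropy :=
  nPointIsotropy_of_routeItems (curvatureDensities_of_temperedCurvatureMoments hT) hSig hKB

end Summit.QuantumFields.YangMills.Theorems.NPointIsotropy.ComplexRotationBandlimit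

end
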